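import Literature.AlgebraicGeometry.Resolution.BlowupChartTransition
import HarnessLib

/-!
# Kawasaki's blow-up: the pieces `M_{(g)}/K_k ≅ (M/bᵏM)_{(g)}` and Claim 3.13.2

Topic: `Literature/AlgebraicGeometry/Resolution`, sequel of `BlowupChartModule.lean` and of
`Literature/RingTheory/LocalCohomology/TwoElementSaturation.lean`. For a chart module
`N = M_{(g)} = R[I/g] · M ⊆ M[1/g]` (`g ∈ I`), an element `c` dividing a power of `g` and an
element `b`, this file identifies the modules entering Česnavičius's proof of Kawasaki's theorem
(Česnavičius 2021, proof of Thm. 3.13, (bam-1)–(bam-4) and Claim 3.13.2) in terms of chart modules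
of quotients of `M`, under the colon hypothesis furnished by Kawasaki's (KI-c)
(`(IⁿM : bᵏ) ⊆ (IⁿM : c) ∩ (IⁿM : b)` for `n ≥ 1`):

* `chartModule.mem_ker_chartModuleMap_pow_iff` — **(bam-4)**: the kernel `K_k` of
  `N → (M/bᵏM)_{(g)}` is the `c`-saturation of `bᵏN` in `N`, i.e. the kernel of
  `φ_b ∘ ψ_k : N → N[1/b]/N → N[1/cb]/sat_c` of `TwoElementSaturation`
  (`chartModule.ker_phi_comp_psi_eq`);
* `chartModule.quotKerPowEquiv` — `N/K_k ≅ (M/bᵏM)_{(g)}`;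
* `chartModuleCongr` — `M_{(g)} ≅ M'_{(g)}` along `M ≅ M'`;
* `chartModule.hkill` — **Claim 3.13.2** in the form consumed by `smul_eq_zero_of_mem_ker_phi`:
  `c` and `b` multiply `sat_c ∩ sat_b ⊆ N[1/cb]` into `N`.

Everything is proved; no named facts.

## References

* [Cesnavicius2021] K. Česnavičius, *Macaulayfication of Noetherian schemes*, Duke Math. J. 170
  (2021), proof of Thm. 3.13 (Claim 3.13.2, (bam-1)–(bam-4)).
* [Kawasaki2000] T. Kawasaki, *On Macaulayfication of Noetherian schemes*, Trans. AMS 352 (2000),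
  Thm. 4.1, Cor. 3.2.
-/

noncomputable section

open IsLocalization Pointwise Literature.RingTheory.LocalCohomology

namespace Literature.AlgebraicGeometry.Resolution

universe u

variable {R : Type u} [CommRing R] (I : Ideal R) (g c b : R)
variable (E : Type u) [AddCommGroup E] [Module R E]

/-! ## Scalars from `R` and from `R[I/g]` -/

/-- `(algebraMap r)ʲ • x = rʲ • x` on `M_{(g)}`. [folklore] -/
theorem algebraMap_pow_smul_chartModule (r : R) (j : ℕ) (x : chartModule I g E) :
    (algebraMap R (blowupAlgebra I g) r) ^ j • x = r ^ j • x := by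
  rw [← map_pow, algebraMap_smul]

/-- `IsSMulRegular` over `R` and over `R[I/g]` agree. [folklore] -/
theorem isSMulRegular_algebraMap_iff {N : Type*} [AddCommGroup N] [Module (blowupAlgebra I g) N]
    [Module R N] [IsScalarTower R (blowupAlgebra I g) N] (r : R) :
    IsSMulRegular N (algebraMap R (blowupAlgebra I g) r) ↔ IsSMulRegular N r := by
  have : (fun x : N => algebraMap R (blowupAlgebra I g) r • x) = fun x : N => r • x :=
    funext fun x => algebraMap_smul _ r x
  unfold IsSMulRegular
  rw [this]

/-! ## The kernel `K_k` of `N → (M/bᵏM)_{(g)}` -/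

variable {E} in
/-- `bᵏ` kills `(M/bᵏM)[1/g]`. [folklore] -/
theorem pow_smul_locQuot_eq_zero (k : ℕ)
    (w : LocalizedModule (Submonoid.powers g) (E ⧸ b ^ k • (⊤ : Submodule R E))) :
    b ^ k • w = 0 := by
  induction w using LocalizedModule.induction_on with
  | h m s =>
    rw [LocalizedModule.smul'_mk, ← LocalizedModule.zero_mk s]
    congr 1
    induction m using Submodule.Quotient.induction_on with | _ m =>
    rw [← Submodule.Quotient.mk_smul, Submodule.Quotient.mk_eq_zero]
    exact Submodule.smul_mem_pointwise_smul _ _ _ Submodule.mem_top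

variable {E} in
/-- **(bam-4): `K_k = ker(N → (M/bᵏM)_{(g)})` is the `c`-saturation of `bᵏ N`** for `c ∣ gⁿ`
under the colon hypothesis `(IⁿM : bᵏ) ⊆ (IⁿM : c)` (`n ≥ 1`).
[cite: Cesnavicius2021, proof of Thm. 3.13, (bam-4)] -/
theorem chartModule.mem_ker_chartModuleMap_pow_iff (hg : g ∈ I) {nc : ℕ} (hc : c ∣ g ^ nc) {k : ℕ}
    (hcolon : ∀ n, 1 ≤ n → ∀ m' : E, b ^ k • m' ∈ I ^ n • (⊤ : Submodule R E) →
      c • m' ∈ I ^ n • (⊤ : Submodule R E))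
    (x : chartModule I g E) :
    x ∈ LinearMap.ker (chartModuleMap I g ((b ^ k • (⊤ : Submodule R E)).mkQ)) ↔
      ∃ (j : ℕ) (x' : chartModule I g E),
        (algebraMap R (blowupAlgebra I g) c) ^ j • x =
          (algebraMap R (blowupAlgebra I g) b) ^ k • x' := by
  constructor
  · intro hx
    have h := chartModule.smul_mem_of_mem_ker I g hg hcolon hx
    rw [Submodule.mem_smul_pointwise_iff_exists] at h
    obtain ⟨x', -, hx'⟩ := h
    refine ⟨1, x', ?_⟩
    rw [pow_one, algebraMap_smul, algebraMap_pow_smul_chartModule, ← hx']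
  · rintro ⟨j, x', hj⟩
    rw [algebraMap_pow_smul_chartModule, algebraMap_pow_smul_chartModule] at hj
    -- `cʲ x ∈ bᵏ N ⊆ ker`, and `cʲ` is regular on `(M/bᵏM)_{(g)}`
    have hcj : c ^ j ∣ g ^ (nc * j) := by rw [pow_mul]; exact pow_dvd_pow_of_dvd hc j
    have hreg : IsSMulRegular (chartModule I g (E ⧸ b ^ k • (⊤ : Submodule R E))) (c ^ j) :=
      chartModule.isSMulRegular_of_dvd I g _ hcj
    rw [LinearMap.mem_ker]
    apply hreg
    dsimp only
    rw [smul_zero, ← LinearMap.map_smul_of_tower, hj, LinearMap.map_smul_of_tower]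
    apply Subtype.ext
    rw [Submodule.coe_smul_of_tower, Submodule.coe_zero, coe_chartModuleMap]
    exact pow_smul_locQuot_eq_zero g b k _

/-! ## `N/K_k ≅ (M/bᵏM)_{(g)}` and chart modules along isomorphisms -/

variable {E} in
/-- `M_{(g)} → M'_{(g)}` is injective for `M → M'` injective. [folklore] -/
theorem chartModuleMap_injective {E' : Type u} [AddCommGroup E'] [Module R E'] {f : E →ₗ[R] E'}
    (hf : Function.Injective f) : Function.Injective (chartModuleMap I g f) := fun x x' h => by
  apply Subtype.ext
  exact IsLocalizedModule.map_injective _ _ _ f hf (congrArg Subtype.val h)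

variable {E} in
/-- **`M_{(g)} ≅ M'_{(g)}` along an isomorphism `M ≅ M'`.** [folklore] -/
def chartModuleCongr {E' : Type u} [AddCommGroup E'] [Module R E'] (e : E ≃ₗ[R] E') :
    chartModule I g E ≃ₗ[blowupAlgebra I g] chartModule I g E' :=
  LinearEquiv.ofBijective (chartModuleMap I g e.toLinearMap)
    ⟨chartModuleMap_injective I g e.injective, chartModuleMap_surjective I g _ e.surjective⟩

variable {E} in
/-- **`N/K_k ≅ (M/bᵏM)_{(g)}`.** [cite: Cesnavicius2021, proof of Thm. 3.13, (bam-1), (bam-4)] -/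
def chartModule.quotKerPowEquiv (k : ℕ) :
    (chartModule I g E ⧸ LinearMap.ker (chartModuleMap I g ((b ^ k • (⊤ : Submodule R E)).mkQ))) ≃ₗ[
      blowupAlgebra I g] chartModule I g (E ⧸ b ^ k • (⊤ : Submodule R E)) :=
  chartModuleQuotKerEquiv I g _ (Submodule.mkQ_surjective _)

/-! ## Claim 3.13.2: `c` and `b` kill `(sat_c ∩ sat_b)/N` -/

variable {E} in
/-- **Claim 3.13.2** (Česnavičius 2021, proof of Thm. 3.13), in the form "`c` and `b` multiply
`sat_c ∩ sat_b ⊆ N[1/cb]` into `N`" for `N = M_{(g)}`: it follows from `b` being `N`-regular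
and from the colon consequences of (KI-c) for all `k ≥ 1`: every `n ∈ N` with `cʲ n ∈ bᵏ N` has
`c n ∈ bᵏ N` and `b n ∈ bᵏ N`. [cite: Cesnavicius2021, proof of Thm. 3.13, Claim 3.13.2] -/
theorem chartModule.hkill {Ω : Type u} [AddCommGroup Ω] [Module (blowupAlgebra I g) Ω]
    (ι : chartModule I g E →ₗ[blowupAlgebra I g] Ω)
    [IsLocalizedModule (Submonoid.powers
      (algebraMap R (blowupAlgebra I g) c * algebraMap R (blowupAlgebra I g) b)) ι]
    (hbN : IsSMulRegular (chartModule I g E) (algebraMap R (blowupAlgebra I g) b))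
    (hK : ∀ k, 1 ≤ k → ∀ n : chartModule I g E,
      (∃ (j : ℕ) (n' : chartModule I g E), (algebraMap R (blowupAlgebra I g) c) ^ j • n =
        (algebraMap R (blowupAlgebra I g) b) ^ k • n') →
      (∃ n₄ : chartModule I g E, algebraMap R (blowupAlgebra I g) c • n =
        (algebraMap R (blowupAlgebra I g) b) ^ k • n₄) ∧
      (∃ n₄ : chartModule I g E, algebraMap R (blowupAlgebra I g) b • n =
        (algebraMap R (blowupAlgebra I g) b) ^ k • n₄)) :
    ∀ ω ∈ sat ι (algebraMap R (blowupAlgebra I g) c) ⊓ sat ι (algebraMap R (blowupAlgebra I g) b),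
      algebraMap R (blowupAlgebra I g) c • ω ∈ LinearMap.range ι ∧
        algebraMap R (blowupAlgebra I g) b • ω ∈ LinearMap.range ι := by
  set cA := algebraMap R (blowupAlgebra I g) c with hcA
  set bA := algebraMap R (blowupAlgebra I g) b with hbA
  intro ω hω
  obtain ⟨⟨i, n₁, hn₁⟩, ⟨k, n₂, hn₂⟩⟩ := hω
  -- bump `k` to `k + 1 ≥ 1`
  have hn₂' : ι (bA • n₂) = bA ^ (k + 1) • ω := by
    rw [LinearMap.map_smul, hn₂, pow_succ', mul_smul]
  -- `bᵏ⁺¹ n₁` and `cⁱ (b n₂)` have the same image, so they agree after multiplying by `(cb)ᵉ`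
  have heq : ι (bA ^ (k + 1) • n₁) = ι (cA ^ i • (bA • n₂)) := by
    rw [LinearMap.map_smul, LinearMap.map_smul, hn₁, hn₂', smul_comm]
  obtain ⟨⟨_, e, rfl⟩, he⟩ :=
    (IsLocalizedModule.eq_iff_exists (Submonoid.powers (cA * bA)) ι).mp heq
  rw [Submonoid.smul_def, Submonoid.smul_def] at he
  change (cA * bA) ^ e • _ = (cA * bA) ^ e • _ at he
  rw [mul_pow, mul_smul, mul_smul] at he
  -- `he : cᵉ bᵉ bᵏ⁺¹ n₁ = cᵉ bᵉ cⁱ (b n₂)`; `n := bᵉ (b n₂)` is in the `c`-saturation of `b^{e+k+1} N`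
  set n : chartModule I g E := bA ^ e • (bA • n₂) with hn
  have hsat : ∃ (j : ℕ) (n' : chartModule I g E), cA ^ j • n = bA ^ (e + (k + 1)) • n' := by
    refine ⟨e + i, cA ^ e • n₁, ?_⟩
    calc cA ^ (e + i) • n = cA ^ e • bA ^ e • cA ^ i • (bA • n₂) := by
          rw [hn, pow_add, mul_smul, smul_comm (cA ^ i) (bA ^ e)]
      _ = cA ^ e • bA ^ e • bA ^ (k + 1) • n₁ := by rw [he]
      _ = bA ^ (e + (k + 1)) • cA ^ e • n₁ := by
          rw [pow_add bA e (k + 1), mul_smul, smul_comm (cA ^ e) (bA ^ e),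
            smul_comm (cA ^ e) (bA ^ (k + 1))]
  obtain ⟨⟨m₁, hm₁⟩, ⟨m₂, hm₂⟩⟩ := hK (e + (k + 1)) (by omega) n hsat
  -- cancel `bᵉ`: `z (b n₂) = bᵏ⁺¹ m`
  have hcancel : ∀ (z : blowupAlgebra I g) (m : chartModule I g E),
      z • n = bA ^ (e + (k + 1)) • m → z • (bA • n₂) = bA ^ (k + 1) • m := by
    intro z m h
    apply hbN.pow e
    dsimp only
    rw [smul_comm, ← hn, h, pow_add bA e (k + 1), mul_smul]
  have h1 := hcancel _ _ hm₁
  have h2 := hcancel _ _ hm₂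
  -- divide by `bᵏ⁺¹` in `Ω`
  have hdiv : ∀ (z : blowupAlgebra I g) (m : chartModule I g E),
      z • (bA • n₂) = bA ^ (k + 1) • m → z • ω = ι m := by
    intro z m h
    apply smul_cancel_of_isUnit (isUnit_smul_pow_right ι cA bA (k + 1))
    rw [smul_comm, ← hn₂', ← LinearMap.map_smul, h, LinearMap.map_smul]
  exact ⟨⟨m₁, (hdiv _ _ h1).symm⟩, ⟨m₂, (hdiv _ _ h2).symm⟩⟩

variable {E} in
/-- **`ker(φ_b ∘ ψ_k) = K_k`**: the kernel of the piece map of `TwoElementSaturation` is the kernel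
of `N → (M/bᵏM)_{(g)}`. [cite: Cesnavicius2021, proof of Thm. 3.13, (bam-4)] -/
theorem chartModule.ker_phi_comp_psi_eq (hg : g ∈ I) {nc : ℕ} (hc : c ∣ g ^ nc)
    {Ω : Type u} [AddCommGroup Ω] [Module (blowupAlgebra I g) Ω]
    (ι : chartModule I g E →ₗ[blowupAlgebra I g] Ω)
    [IsLocalizedModule (Submonoid.powers
      (algebraMap R (blowupAlgebra I g) c * algebraMap R (blowupAlgebra I g) b)) ι]
    {Nb : Type u} [AddCommGroup Nb] [Module (blowupAlgebra I g) Nb]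
    (ιb : chartModule I g E →ₗ[blowupAlgebra I g] Nb)
    [IsLocalizedModule (Submonoid.powers (algebraMap R (blowupAlgebra I g) b)) ιb]
    (hcN : IsSMulRegular (chartModule I g E) (algebraMap R (blowupAlgebra I g) c))
    (hbN : IsSMulRegular (chartModule I g E) (algebraMap R (blowupAlgebra I g) b)) {k : ℕ}
    (hcolon : ∀ n, 1 ≤ n → ∀ m' : E, b ^ k • m' ∈ I ^ n • (⊤ : Submodule R E) →
      c • m' ∈ I ^ n • (⊤ : Submodule R E)) :
    LinearMap.ker (phi ι ιb (algebraMap R (blowupAlgebra I g) c) (algebraMap R (blowupAlgebra I g) b) ∘ₗ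
        psi ιb (algebraMap R (blowupAlgebra I g) b) k) =
      LinearMap.ker (chartModuleMap I g ((b ^ k • (⊤ : Submodule R E)).mkQ)) := by
  ext x
  rw [mem_ker_phi_comp_psi_iff ι ιb _ _ hcN hbN,
    chartModule.mem_ker_chartModuleMap_pow_iff I g c b hg hc hcolon]

end Literature.AlgebraicGeometry.Resolution

end
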